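import Summits.KontsevichZagierPeriods.KontsevichZagierPeriods.Theorems.CompleteModGammaSector.Negative.LoadBearing
import Summits.KontsevichZagierPeriods.KontsevichZagierPeriods.Theorems.GammaHodgeSector.Negative.HodgeTest
import Literature.NumberTheory.Transcendental.KZSubcalculusInvariants

/-!
# `CompleteModGammaSector` (stmt-KontsevichZagierPeriods-14233) — negative side II: the dimension-0
evaluation `ev₀` (Newton–Leibniz is load-bearing modulo the Γ-sector) and the coefficient sum
(additivity is load-bearing for the kernel form)

Landed copy of §4 of `Cruxes/GammaSectorComplete/Disproof.lean`: `ev₀ := KZ.restrictedEval` at the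
window family "everything in dimension 0, nothing above" is an additive invariant of rules (1a),
(1b), (2) (`rulesOneTwo_le_ker_ev₀`) and of every Γ-Hodge pair (`closure_gammaHodgePairs_le_ker_ev₀`,
from the weight balance of the Hodge test), but not of rule (3) (`ev₀_witness`,
`newtonLeibnizRel_not_subset_ker_ev₀`). Consequence: the crux with `relations` shrunk to rules
(1), (2) is FALSE at the rational pair `[pt,1]`, `[[0,1],1]`
(`completeModGammaSector_false_without_newtonLeibniz`); a fortiori the Γ-Hodge pairs alone connect
nothing outside their shapes (`not_completeByHodgePairsOnly`); the same pair is a true instance of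
the crux (`witness_mem_sector`). And §6: `coeffSum` kills rules (2), (3) and all Γ-Hodge pairs, so
the kernel form `ker eval ≤ sector` needs rule (1): `kernelForm_false_without_additivity`
(witness `[pt,2] − 2•[pt,1]`, a relation of coefficient sum `−1`).
-/

noncomputable section

open MeasureTheory Set
open scoped BigOperators

namespace Summit.KontsevichZagierPeriods.CompleteModGammaSectorNegative

open Literature.NumberTheory.Transcendental
open Literature.NumberTheory.Transcendental.KZ
open Summit.KontsevichZagierPeriods.KontsevichZagierPeriods.Theses.TerasomaMultiplication
  (CompleteModGammaSector GammaHodgeSector closes)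
open Summit.KontsevichZagierPeriods.GammaHodgeSectorNegative
open Literature.Barriers.KontsevichZagierPeriods.KZ (constRep constRep_value constRep_isRational)

/-! ## §4 Which moves bear load modulo the sector: the dimension-0 evaluation `ev₀` -/

/-- The window family of `ev₀`: everything in dimension `0`, nothing in positive dimension. -/
def dimZeroWindow : (n : ℕ) → Set (Fin n → ℝ)
  | 0 => univ
  | _ + 1 => ∅

/-- The windows are measurable. [folklore] -/
theorem measurableSet_dimZeroWindow : ∀ n, MeasurableSet (dimZeroWindow n)
  | 0 => MeasurableSet.univ
  | _ + 1 => MeasurableSet.empty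

/-- **Dimension-0 evaluation**: the additive map reading off the value of the dimension-0
generators and ignoring all others (`KZ.restrictedEval` at the window family `dimZeroWindow`).
[folklore] -/
def ev₀ : FormalRep →+ ℝ := restrictedEval dimZeroWindow

/-- `ev₀ [r] = r.value` in dimension `0`. [folklore] -/
theorem ev₀_of_zero (r : IntegralRep 0) : ev₀ (of r) = r.value := by
  simp [ev₀, dimZeroWindow, IntegralRep.value]

/-- `ev₀ [r] = 0` in positive dimension. [folklore] -/
theorem ev₀_of_succ {n : ℕ} (r : IntegralRep (n + 1)) : ev₀ (of r) = 0 := by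
  simp [ev₀, dimZeroWindow]

/-- `ev₀ [r] = r.value` whenever the dimension is `0` (index-robust form). [folklore] -/
theorem ev₀_of_eq_value {n : ℕ} (hn : n = 0) (r : IntegralRep n) : ev₀ (of r) = r.value := by
  subst hn
  exact ev₀_of_zero r

/-- `ev₀ [r] = 0` whenever the dimension is non-zero (index-robust form). [folklore] -/
theorem ev₀_of_eq_zero {n : ℕ} (hn : n ≠ 0) (r : IntegralRep n) : ev₀ (of r) = 0 := by
  obtain ⟨m, rfl⟩ := Nat.exists_eq_succ_of_ne_zero hn
  exact ev₀_of_succ r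

/-- Rules (1a), (1b) preserve `ev₀` (an instance of `KZ.closure_add_le_ker_restrictedEval`).
[cite: KontsevichZagier2001, §1.2 rule (1)] -/
theorem closure_add_le_ker_ev₀ :
    AddSubgroup.closure (domainAddRel ∪ integrandAddRel) ≤ ev₀.ker :=
  closure_add_le_ker_restrictedEval _ measurableSet_dimZeroWindow

/-- Rule (2) preserves `ev₀`: a change of variables stays in one dimension; in dimension `0` it is
sound (`eval`), in positive dimension both terms are invisible. [cite: KontsevichZagier2001, §1.2 rule (2)] -/
theorem ev₀_eq_zero_of_mem_changeOfVariablesRel {c : FormalRep} (hc : c ∈ changeOfVariablesRel) :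
    ev₀ c = 0 := by
  have he : eval c = 0 := eval_eq_zero_of_mem_changeOfVariablesRel_holds hc
  obtain ⟨n, r, r', Φ, Φ', -, -, -, -, -, rfl⟩ := hc
  rcases Nat.eq_zero_or_pos n with hn | hn
  · rw [map_sub, ev₀_of_eq_value hn, ev₀_of_eq_value hn]
    rwa [eval_of_sub_of] at he
  · rw [map_sub, ev₀_of_eq_zero hn.ne', ev₀_of_eq_zero hn.ne', sub_zero]

/-- The subgroup generated by rules (1a), (1b), (2) — everything except Newton–Leibniz. -/
def rulesOneTwo : AddSubgroup FormalRep :=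
  AddSubgroup.closure (domainAddRel ∪ integrandAddRel ∪ changeOfVariablesRel)

/-- `rulesOneTwo ≤ relations`. [folklore] -/
theorem rulesOneTwo_le_relations : rulesOneTwo ≤ relations := by
  unfold rulesOneTwo relations
  exact AddSubgroup.closure_mono Set.subset_union_left

/-- **Rules (1), (2) preserve `ev₀`.** [cite: KontsevichZagier2001, §1.2] -/
theorem rulesOneTwo_le_ker_ev₀ : rulesOneTwo ≤ ev₀.ker := by
  refine (AddSubgroup.closure_le _).mpr ?_
  rintro c ((hc | hc) | hc)
  · exact closure_add_le_ker_ev₀ (AddSubgroup.subset_closure (Or.inl hc))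
  · exact closure_add_le_ker_ev₀ (AddSubgroup.subset_closure (Or.inr hc))
  · exact ev₀_eq_zero_of_mem_changeOfVariablesRel hc

/-- **Every Γ-Hodge pair preserves `ev₀`.** By the weight balance `N + I = N' + I' + 2k` of the
Hodge test (tree: `hodge_weight_balance`), `N = 0` forces `N' = k = 0` — then both
representations are dimension-0 with equal values — and `N ≥ 1` forces `2k + N' ≥ 1` — then both
are invisible. So the Γ-sector never touches dimension `0` non-trivially. [folklore] -/
theorem ev₀_eq_zero_of_mem_gammaHodgePairs {d : FormalRep} (hd : d ∈ gammaHodgePairs) : ev₀ d = 0 := by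
  obtain ⟨N, N', k, x, y, x', y', c, ρ, ρ', hx, hx', hH, -, -, -, hv, rfl⟩ := mem_gammaHodgePairs_iff.mp hd
  rcases Nat.eq_zero_or_pos N with hN | hN
  · subst hN
    obtain ⟨hN', hk⟩ := eq_zero_of_N_eq_zero hx' hH
    have h0 : 2 * k + N' = 0 := by omega
    rw [map_sub, ev₀_of_eq_value rfl ρ, ev₀_of_eq_value h0 ρ', hv, sub_self]
  · have hb := hodge_weight_balance hx hx' hH
    have hI' := intSums_le x' y'
    have h1 : 2 * k + N' ≠ 0 := by omega
    rw [map_sub, ev₀_of_eq_zero hN.ne' ρ, ev₀_of_eq_zero h1 ρ', sub_zero]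

/-- The closure of the Γ-Hodge pairs lies in `ker ev₀`. [folklore] -/
theorem closure_gammaHodgePairs_le_ker_ev₀ : AddSubgroup.closure gammaHodgePairs ≤ ev₀.ker :=
  (AddSubgroup.closure_le _).mpr fun _ hd => ev₀_eq_zero_of_mem_gammaHodgePairs hd

/-- **`ev₀` is an invariant of rules (1), (2) and all Γ-Hodge pairs.** [folklore] -/
theorem rulesOneTwo_sup_closure_le_ker_ev₀ :
    rulesOneTwo ⊔ AddSubgroup.closure gammaHodgePairs ≤ ev₀.ker :=
  sup_le rulesOneTwo_le_ker_ev₀ closure_gammaHodgePairs_le_ker_ev₀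

/-- The witness `[[0,1], 1]`: the slab of height one over `[pt, 1]` (tree construction
`KZ.IntegralRep.slab`), a dimension-1 representation of `1`. -/
def unitIntervalRep : IntegralRep 1 := (constRep 1).slab 0

/-- `[[0,1], 1]` has KZ's literal (rational) shape (`p = q = 1`). [folklore] -/
theorem unitIntervalRep_isRational : unitIntervalRep.IsRational :=
  ⟨1, 1, fun _ _ => by simp, fun z _ => by simp [unitIntervalRep, constRep]⟩

/-- `[[0,1],1] − [pt,1]` is ONE Newton–Leibniz move (primitive `F (t) = t`). [cite: KontsevichZagier2001, §1.2 rule (3)] -/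
theorem of_unitIntervalRep_sub_mem_newtonLeibnizRel :
    of unitIntervalRep - of (constRep 1) ∈ newtonLeibnizRel :=
  (constRep 1).of_slab_sub_of_mem_newtonLeibnizRel 0

/-- `value [[0,1], 1] = 1` (read off from soundness of the slab move). [folklore] -/
theorem unitIntervalRep_value : unitIntervalRep.value = 1 := by
  have h := Equivalent.value_eq_holds ((constRep 1).equivalent_slab 0)
  rw [constRep_value] at h
  have h' : unitIntervalRep.value = ((1 : ℚ) : ℝ) := h.symm
  rw [h', Rat.cast_one]

/-- `ev₀` SEES the Newton–Leibniz move `[pt,1] − [[0,1],1]`: it evaluates to `1`. [folklore] -/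
theorem ev₀_witness : ev₀ (of (constRep 1) - of unitIntervalRep) = 1 := by
  rw [map_sub, ev₀_of_zero, ev₀_of_eq_zero one_ne_zero unitIntervalRep, sub_zero, constRep_value,
    Rat.cast_one]

/-- In particular rule (3) is NOT in the kernel of `ev₀` (so `ev₀` is not an invariant of the full
calculus — as it must not be, being different from `eval`). [folklore] -/
theorem newtonLeibnizRel_not_subset_ker_ev₀ : ¬ (newtonLeibnizRel ⊆ (ev₀.ker : Set FormalRep)) := by
  intro h
  have h0 : ev₀ (of unitIntervalRep - of (constRep 1)) = 0 := h of_unitIntervalRep_sub_mem_newtonLeibnizRel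
  rw [← neg_sub, map_neg, ev₀_witness] at h0
  norm_num at h0

/-- **Newton–Leibniz is load-bearing even modulo every Γ-Hodge identity.** The rational pair
`[pt, 1]`, `[[0,1], 1]` (value `1 = ∫₀¹ dt`) is separated from `rulesOneTwo ⊔ closure(Γ-Hodge
pairs)` by `ev₀`. Any proof of the crux must use rule (3) — already to leave dimension `0`.
[folklore] -/
theorem completeModGammaSector_false_without_newtonLeibniz :
    ¬ (∀ ⦃n m : ℕ⦄ (r : IntegralRep n) (r' : IntegralRep m),
        r.IsRational → r'.IsRational → r.value = r'.value →
          of r - of r' ∈ rulesOneTwo ⊔ AddSubgroup.closure gammaHodgePairs) := by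
  intro h
  have hmem := h (constRep 1) unitIntervalRep (constRep_isRational 1) unitIntervalRep_isRational
    (by rw [constRep_value, unitIntervalRep_value, Rat.cast_one])
  have h0 : ev₀ (of (constRep 1) - of unitIntervalRep) = 0 := rulesOneTwo_sup_closure_le_ker_ev₀ hmem
  rw [ev₀_witness] at h0
  exact one_ne_zero h0

/-- **The Γ-Hodge pairs alone are far from complete** (corollary of the previous theorem).
[folklore] -/
theorem not_completeByHodgePairsOnly :
    ¬ (∀ ⦃n m : ℕ⦄ (r : IntegralRep n) (r' : IntegralRep m),
        r.IsRational → r'.IsRational → r.value = r'.value →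
          of r - of r' ∈ AddSubgroup.closure gammaHodgePairs) :=
  fun h => completeModGammaSector_false_without_newtonLeibniz
    fun _ _ r r' hr hr' hv => AddSubgroup.mem_sup_right (h r r' hr hr' hv)

/-- NON-VACUITY / the witness instance is TRUE: `[pt,1] − [[0,1],1] ∈ sector` (indeed `∈ relations`,
one rule-(3) move). So the pair of §4 refutes only the NL-free strengthening, not the crux.
[folklore] -/
theorem witness_mem_sector : of (constRep 1) - of unitIntervalRep ∈ sector := by
  refine AddSubgroup.mem_sup_left ?_
  have h : of unitIntervalRep - of (constRep 1) ∈ relations :=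
    newtonLeibnizRel_subset_relations of_unitIntervalRep_sub_mem_newtonLeibnizRel
  simpa using relations.neg_mem h

/-! ## §6 Rule (1) bears load for the KERNEL form: the coefficient sum

For the two-term conclusion `[r] − [r'] ∈ sector` the tree's coefficient sum `KZ.coeffSum` is
blind (`1 − 1 = 0`), so additivity's necessity cannot be witnessed there by it (whether rules
(2), (3) plus the Γ-Hodge pairs already connect every equal-valued rational pair is open — it
would need an invariant of the single-move graph on generators). But the KERNEL form of the crux
(`completeModGammaSector_iff_ker_le`: `ker eval ≤ sector`) has three-term instances, and there
additivity is load-bearing: `coeffSum` kills rules (2), (3) (tree: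
`KZ.closure_cov_nl_le_ker_coeffSum`) and every Γ-Hodge pair, while the kernel element
`[pt, 2·1] − 2•[pt, 1]` (a relation, by integrand additivity: tree
`of_constMul_nat_sub_nsmul_mem_relations`) has coefficient sum `−1`. -/

section RuleOne

/-- The subgroup generated by rules (2), (3) — no additivity. -/
def rulesTwoThree : AddSubgroup FormalRep :=
  AddSubgroup.closure (changeOfVariablesRel ∪ newtonLeibnizRel)

/-- Every Γ-Hodge pair difference has coefficient sum `0`. [folklore] -/
theorem coeffSum_eq_zero_of_mem_gammaHodgePairs {d : FormalRep} (hd : d ∈ gammaHodgePairs) :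
    coeffSum d = 0 := by
  obtain ⟨N, N', k, x, y, x', y', c, ρ, ρ', -, -, -, -, -, -, -, rfl⟩ := mem_gammaHodgePairs_iff.mp hd
  simp

/-- **`coeffSum` kills rules (2), (3) and all Γ-Hodge pairs.** [folklore] -/
theorem rulesTwoThree_sup_closure_le_ker_coeffSum :
    rulesTwoThree ⊔ AddSubgroup.closure gammaHodgePairs ≤ coeffSum.ker :=
  sup_le closure_cov_nl_le_ker_coeffSum
    ((AddSubgroup.closure_le _).mpr fun _ hd => coeffSum_eq_zero_of_mem_gammaHodgePairs hd)

/-- The three-term kernel element `[pt, 2] − 2•[pt, 1]` (integrand scaled by `2`). -/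
def scalingWitness : FormalRep :=
  of ((constRep 1).constMul ((2 : ℕ) : ℝ) (isAlgebraic_nat 2)) - 2 • of (constRep 1)

/-- The scaling witness is a relation (two integrand-additivity moves; tree). [cite: KontsevichZagier2001, §1.2 rule (1)] -/
theorem scalingWitness_mem_relations : scalingWitness ∈ relations :=
  (constRep 1).of_constMul_nat_sub_nsmul_mem_relations 2

/-- … hence it lies in `ker eval` (soundness) and in `sector`. [folklore] -/
theorem scalingWitness_mem_ker_eval : scalingWitness ∈ eval.ker :=
  relations_le_ker_eval_holds scalingWitness_mem_relations

/-- Its coefficient sum is `−1`. [folklore] -/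
theorem coeffSum_scalingWitness : coeffSum scalingWitness = -1 := by
  simp [scalingWitness]

/-- **Additivity is load-bearing for the kernel form of the crux**: `ker eval` is NOT contained in
`rulesTwoThree ⊔ closure(Γ-Hodge pairs)`. So a proof of `ker eval ≤ sector` must use rule (1)
(already to scale an integrand by `2`). [folklore] -/
theorem kernelForm_false_without_additivity :
    ¬ (eval.ker ≤ rulesTwoThree ⊔ AddSubgroup.closure gammaHodgePairs) := by
  intro h
  have h0 : coeffSum scalingWitness = 0 :=
    rulesTwoThree_sup_closure_le_ker_coeffSum (h scalingWitness_mem_ker_eval)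
  rw [coeffSum_scalingWitness] at h0
  norm_num at h0

end RuleOne

end Summit.KontsevichZagierPeriods.CompleteModGammaSectorNegative
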